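import Mathlib
import HarnessLib
import Literature.AlgebraicGeometry.Resolution.CobordantBlowupRegularCentre
import Summits.ResolutionOfSingularities.ResolutionOfSingularities.Theorems.WildQuotientsWildQuotientResolutionS1aKillChains
import Summits.ResolutionOfSingularities.ResolutionOfSingularities.Theorems.WildQuotientsWildQuotientResolutionS1aJ22KillsIn

/-!
# S1a — TRIANGULAR ROOT KILLS: every datum of CHAIN TYPE in the coordinates of `X′` is killed by ONE move (`KillsIn 1 (initial)`), any number of variables

[OURS · L1 W4.5c · lead-1 g14; the instance programme of plan-1 RULING R-F15g made a FAMILY: the KillCert pipeline (✓p644505) run with the chain-type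
certificate KC5 (`cobordantKillCert_of_chains`, `…S1aKillChains`) on the single chart `X′`] — NOT statements of the manuscript; counted 0; AI-level work,
weaker than expert review. Crux stmt-ResolutionOfSingularities-17941 `CyclicQuotientFourfolds`, line `s1a-logminvertex` v13 (`stub_reachLowerInFX`).
A BC5-type FAMILY OF RUNGS of the research stub, not the stub.

THE TRIANGULAR DATUM. Action data `(X′, X₁, q, ρ, g₀)` with `X′` AFFINE regular, `e : Γ(X′, ⊤) ≃ k[x_ι]` intertwining `g₀` with a ring
automorphism `σ` fixing constants, and a candidate centre: distinct variables `x_{v(0)}, …, x_{v(c−1)}` (`v` injective, `c > 0`) with positive weights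
`w`, `𝒥ₙ` their weighted filtration, such that
* (T1) ROWS: `σ xᵢ − xᵢ ∈ 𝒥₁` for every variable and `σ x_{v l} − x_{v l} ∈ 𝒥_{w l + 1}` for every centre variable ((a′) with `β = 1`, `δ = 1`);
* (T2) ISOLATION: `(x_{v l})^N ≤ augIdeal σ` (the centre contains the fixed locus);
* (T3) CHAINS: for every `l` some `u ∈ 𝒥_{w l − 1}` and unit `h` with `σ u − u − h x_{v l} ∈ 𝒥_{w l + 1}`.
Then the weighted blow-up of `(x_{v l}; w)` is a PRINCIPAL CENTRE of the game on the initial model with `X′` itself a principal-centre chart, hence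
`KillsIn 1 (initial)` and the conclusion of `ReachLowerInF(X)` for every root decoration. INHABITANTS (each previously one file): `J₄` (✓p645001/✓p660379:
`v = (0,1,2)`, `w = (3,2,1)`, `u = (x₁, x₂, x₃)`), `J₃ ⊕ J₁` (`…S1aJ3KillsIn`), `J₂ ⊕ J₂` (`…S1aJ22KillsIn`), and — new — the transvection `J₂ ⊕ 1 ⊕ 1` and
the triangular germ sm of X-CERT v1.3-SMALLP (`x₁ ↦ x₁ + x₀, x₂ ↦ x₂ + x₀, x₃ ↦ x₃ + x₂`; centre (x₀:2, x₂:1)), both below as corollaries; every direct sum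
of unipotent Jordan blocks in any number of variables is of this type (exact chains, `h = 1`).
* `closure_range_C_union_range_X_of`, `isRegular_X_comp`, `isRegularRing_quotient_X_comp` — generation and K1′ for distinct variables (any index type);
* ★★★ `exists_isPrincipalCentre_initial_of_triangular` — the datum-level move (all `p`, all `m`);
* ★★★ `triangular_killsIn_one : KillsIn 1 (GModel.initial hq h₀)`, ★★★ `exists_reachLowerF_initial_of_triangular`;
* corollaries ★ `sm_killsIn_one` (I-5 menu «sm», every `p`; datum inhabited for `p ≥ 3`), ★ `transvection_killsIn_one` (every `p`).
-/

set_option linter.dupNamespace false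

noncomputable section

open CategoryTheory Limits AlgebraicGeometry TopologicalSpace Topology Opposite MvPolynomial
open Literature.AlgebraicGeometry.Resolution Literature.AlgebraicGeometry.RelativeSpec
open Summit.ResolutionOfSingularities.ResolutionOfSingularities.Theorems.WildQuotientResolution.S1
open Summit.ResolutionOfSingularities.ResolutionOfSingularities.Theorems.WildQuotientResolution.S1.NodeAtlas
open Summit.ResolutionOfSingularities.ResolutionOfSingularities.Theorems.WildQuotientResolution.S1.KillCert
open Summit.ResolutionOfSingularities.ResolutionOfSingularities.Theorems.WildQuotientResolution.S1.GoodCharts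
open Summit.ResolutionOfSingularities.ResolutionOfSingularities.Theorems.WildQuotientResolution.S1.NpFrame

namespace Summit.ResolutionOfSingularities.ResolutionOfSingularities.Theorems.WildQuotientResolution.S1.KillCert

/-! ## K1′ for any family of distinct variables -/

section Poly

open Literature.AlgebraicGeometry.Resolution.MvPolynomial

variable (k : Type) [Field k] {ι : Type} [Fintype ι] [DecidableEq ι] {c : ℕ}

/-- `k[x_ι]` is generated as a ring by the constants and the variables (any index type). [folklore] -/
theorem closure_range_C_union_range_X_of (ι : Type) :
    Subring.closure (Set.range (C : k → MvPolynomial ι k) ∪ Set.range (X : ι → MvPolynomial ι k)) = ⊤ := by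
  have h := Algebra.adjoin_eq_ring_closure (R := k) (Set.range (X : ι → MvPolynomial ι k))
  rw [adjoin_range_X] at h
  rw [← show (algebraMap k (MvPolynomial ι k) : k → MvPolynomial ι k) = C from rfl, ← h]
  rfl

omit [Fintype ι] [DecidableEq ι] in
/-- Distinct variables form a regular sequence on `k[x_ι]`. [folklore] -/
theorem isRegular_X_comp (v : Fin c → ι) (hv : Function.Injective v) :
    RingTheory.Sequence.IsRegular (MvPolynomial ι k) (List.ofFn (X ∘ v : Fin c → MvPolynomial ι k)) := by
  have hl : List.ofFn (X ∘ v : Fin c → MvPolynomial ι k) = (List.ofFn v).map X := by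
    rw [List.map_ofFn]
  rw [hl]
  refine ⟨isWeaklyRegular_map_X (R := k) (List.ofFn v) (List.nodup_ofFn.mpr hv), ?_⟩
  intro htop
  rw [smul_eq_mul, Ideal.mul_top] at htop
  have h1 : (1 : MvPolynomial ι k) ∈ Ideal.ofList ((List.ofFn v).map (X : ι → MvPolynomial ι k)) := by
    rw [← htop]; trivial
  have hle : Ideal.ofList ((List.ofFn v).map (X : ι → MvPolynomial ι k)) ≤
      RingHom.ker (constantCoeff : MvPolynomial ι k →+* k) := by
    rw [Ideal.ofList, Ideal.span_le]
    intro x hx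
    obtain ⟨i, -, rfl⟩ := List.mem_map.mp hx
    simp [RingHom.mem_ker, constantCoeff_X]
  have := hle h1
  rw [RingHom.mem_ker, map_one] at this
  exact one_ne_zero this

omit [DecidableEq ι] in
/-- `k[x_ι]/(x_{v 0}, …, x_{v (c-1)})` is a polynomial ring, hence regular. [folklore] -/
theorem isRegularRing_quotient_X_comp (v : Fin c → ι) :
    IsRegularRing (MvPolynomial ι k ⧸ Ideal.span (Set.range (X ∘ v : Fin c → MvPolynomial ι k))) := by
  rw [Set.range_comp]
  haveI : IsRegularRing (MvPolynomial {l : ι // l ∉ Set.range v} k) := inferInstance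
  exact IsRegularRing.of_ringEquiv (quotientSpanXEquiv (R := k) (Set.range v)).toRingEquiv.symm

end Poly

end Summit.ResolutionOfSingularities.ResolutionOfSingularities.Theorems.WildQuotientResolution.S1.KillCert

namespace Summit.ResolutionOfSingularities.ResolutionOfSingularities.Theorems.WildQuotientResolution.S1.GameFrame.GModel

open KillCert

variable {p : ℕ} {X' X₁ : Scheme.{0}} {q : X' ⟶ X₁} {G : Type} [Group G] {ρ : G →* Aut X'} {g₀ : G}

/-- ★★★ **A TRIANGULAR DATUM IS KILLED BY ONE MOVE OF THE GAME (all `p`, any number of variables).** Let `(X′, X₁, q, ρ, g₀)` be action data with `X′`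
AFFINE, regular, locally Noetherian and separated, `X₁` separated, `q` affine and `G`-invariant, `G` finite, `g₀ ^ p = 1`, and let
`e : Γ(X′, ⊤) ≃+* k[x_ι]` intertwine the action of `g₀` on global sections with a ring automorphism `σ` fixing constants. Let distinct variables
`x_{v l}` (`c > 0` of them) with positive weights `w` satisfy (T1) rows, (T2) isolation and (T3) chains (module docstring). Then on the INITIAL MODEL the
weighted centre `(e⁻¹x_{v l}; w)` IS a legal PRINCIPAL (kill) move: `∃ 𝒦 d, IsPrincipalCentre p _ g₀ 𝒦 d` whose filtration on `X′` is `𝒥ₙ((e⁻¹x_{v l}), w)`,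
whose support is EXACTLY `V(e⁻¹x_{v l})`, and for which every stable affine chart with underlying open `⊤` (i.e. `X′`) is a principal-centre chart.
[OURS · L1 W4.5c · instance programme R-F15g made a family; NOT a statement of the manuscript] -/
theorem exists_isPrincipalCentre_initial_of_triangular [Finite G] (hp : 0 < p) (hG : ∀ g : G, g ∈ Subgroup.zpowers g₀) (hg₀ : g₀ ^ p = 1)
    (hq : ∀ g : G, (ρ g).hom ≫ q = q) [IsIntegral X'] [IsLocallyNoetherian X'] [X'.IsSeparated] [IsAffine X'] [X₁.IsSeparated] [IsAffineHom q]
    (hreg : Scheme.IsRegular X') {k : Type} [Field k] {ι : Type} [Fintype ι] [DecidableEq ι] (σ : MvPolynomial ι k ≃+* MvPolynomial ι k) (hC : ∀ a : k, σ (C a) = C a)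
    {c : ℕ} (hc : 0 < c) (v : Fin c → ι) (hv : Function.Injective v) (w : Fin c → ℕ) (hw : ∀ l, 0 < w l)
    (hrow : ∀ i : ι, σ (X i) - X i ∈ (weightedFiltration (X ∘ v : Fin c → MvPolynomial ι k) w).ideal 1)
    (hrowc : ∀ l : Fin c, σ (X (v l)) - X (v l) ∈ (weightedFiltration (X ∘ v : Fin c → MvPolynomial ι k) w).ideal (w l + 1))
    (hiso : ∃ N : ℕ, Ideal.span (Set.range (X ∘ v : Fin c → MvPolynomial ι k)) ^ N ≤ augmentationIdeal σ)
    (hchain : ∀ l : Fin c, ∃ u h : MvPolynomial ι k, IsUnit h ∧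
      u ∈ (weightedFiltration (X ∘ v : Fin c → MvPolynomial ι k) w).ideal (w l - 1) ∧
      σ u - u - h * X (v l) ∈ (weightedFiltration (X ∘ v : Fin c → MvPolynomial ι k) w).ideal (w l + 1))
    (e : Γ(X', ⊤) ≃+* MvPolynomial ι k)
    (hστ : ∀ t : Γ(X', ⊤), e ((ρ g₀⁻¹).hom.appLE ⊤ ⊤ (by rw [Scheme.Hom.preimage_top]) t) = σ (e t)) :
    letI h₀ : NodeAtlas p (⟨ρ, hq⟩ : ActionOver q G) g₀ := stub_initialAtlas p hp q G ρ g₀ hg₀ hq hreg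
    ∃ (𝒦 : ReesFiltration X') (d : ℕ), IsPrincipalCentre p (GModel.initial hq h₀).act g₀ 𝒦 d ∧
      (∀ n, (𝒦.filtration ⟨⊤, isAffineOpen_top X'⟩).ideal n = (weightedFiltration (fun l => e.symm (X (v l))) w).ideal n) ∧
      (((𝒦.ideal d).support : Set X')) = X'.zeroLocus (U := ⊤) (Set.range fun l => e.symm (X (v l))) ∧
      ∀ O : (GModel.initial hq h₀).act.StableAffineOpens, O.1 = ⊤ → IsPrincipalCentreChart p (GModel.initial hq h₀).act g₀ 𝒦 d O := by
  classical
  -- the one chart: all of `X′`, affine over `X₁`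
  haveI : IsAffine (⊤ : X'.Opens) := isAffineOpen_top X'
  have hAff : IsAffineHom ((⊤ : X'.Opens).ι ≫ q) := inferInstance
  have hst : ∀ g : G, (ρ g).hom ⁻¹ᵁ (⊤ : X'.Opens) = ⊤ := fun g => Scheme.Hom.preimage_top _
  let O : (⟨ρ, hq⟩ : ActionOver q G).StableAffineOpens := ⟨⊤, hst, hAff⟩
  have hO : IsAffineOpen O.1 := isAffineOpen_top X'
  haveI hsep : (GModel.initial hq (stub_initialAtlas p hp q G ρ g₀ hg₀ hq hreg) : GModel p q G ρ g₀).V.IsSeparated := ‹X'.IsSeparated›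
  -- the frame in `A = Γ(X′, ⊤)` and the automorphism `τ = g₀` acting on it
  let A := Γ(X', (⊤ : X'.Opens))
  let τ : A ≃+* A := actOEquiv (⟨ρ, hq⟩ : ActionOver q G) O g₀
  let ε : MvPolynomial ι k →+* A := (e.symm : MvPolynomial ι k →+* A)
  let f : Fin c → A := fun l => e.symm (X (v l))
  have hact : ∀ t : A, τ t = e.symm (σ (e t)) := fun t => by
    apply e.injective
    rw [e.apply_symm_apply, ← hστ]
    rfl
  have hactX : ∀ y, τ (e.symm y) = e.symm (σ y) := fun y => by rw [hact, e.apply_symm_apply]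
  have hinc : ∀ y, τ (e.symm y) - e.symm y = e.symm (σ y - y) := fun y => by rw [hactX, map_sub]
  -- transport of the weighted filtration along `e⁻¹`
  have hJ : ∀ n, ((weightedFiltration (X ∘ v : Fin c → MvPolynomial ι k) w).ideal n).map ε = (weightedFiltration f w).ideal n :=
    fun n => Literature.AlgebraicGeometry.Resolution.map_weightedFiltration_ideal _ w ε n
  have hmemJ : ∀ {n : ℕ} {y : MvPolynomial ι k}, y ∈ (weightedFiltration (X ∘ v : Fin c → MvPolynomial ι k) w).ideal n →
      e.symm y ∈ (weightedFiltration f w).ideal n := fun {n} {y} hy => by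
    rw [← hJ n]
    exact Ideal.mem_map_of_mem ε hy
  have h1J : ∀ {n : ℕ} {y : A}, y ∈ (weightedFiltration f w).ideal n → y ∈ Ideal.span {(1 : A)} * (weightedFiltration f w).ideal n :=
    fun hy => by rw [Ideal.span_singleton_one, Ideal.top_mul]; exact hy
  -- (a′): `τ` moves `𝒥ₙ` within `𝒥ₙ₊₁` — checked on the generators `e⁻¹(C a)`, `e⁻¹(xᵢ)` of `A`
  have hgen : Subring.closure (e.symm '' (Set.range (C : k → MvPolynomial ι k) ∪ Set.range (X : ι → MvPolynomial ι k))) = ⊤ := by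
    show Subring.closure (ε '' _) = ⊤
    rw [← RingHom.map_closure, closure_range_C_union_range_X_of k ι, ← RingHom.range_eq_map]
    exact RingHom.range_eq_top.mpr e.symm.surjective
  have hadm : ∀ (n : ℕ) (y : A), y ∈ (weightedFiltration f w).ideal n →
      τ y - y ∈ Ideal.span {(1 : A)} * (weightedFiltration f w).ideal (n + 1) := by
    refine admissible_of_generators f w τ 1 _ hgen ?_ ?_
    · rintro _ ⟨g, hg | hg, rfl⟩
      · obtain ⟨a, rfl⟩ := hg
        rw [hactX, hC, sub_self]; exact Ideal.zero_mem _
      · obtain ⟨i, rfl⟩ := hg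
        rw [hinc]; exact h1J (hmemJ (hrow i))
    · intro l
      change τ (e.symm (X (v l))) - e.symm (X (v l)) ∈ _
      rw [hinc]; exact h1J (hmemJ (hrowc l))
  have hσJ : ∀ n : ℕ, ((weightedFiltration f w).ideal n).map (τ : A →+* A) ≤ (weightedFiltration f w).ideal n :=
    map_le_of_admissible f w τ 1 hadm
  -- (ii): isolation, transported
  have haug : (augmentationIdeal σ).map ε ≤ augmentationIdeal τ := by
    rw [augmentationIdeal, Ideal.map_span, Ideal.span_le]
    rintro _ ⟨_, ⟨b, rfl⟩, rfl⟩
    change e.symm (σ b - b) ∈ augmentationIdeal τ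
    rw [← hinc]
    exact sub_mem_augmentationIdeal τ _
  have hspan : Ideal.span (Set.range f) = (Ideal.span (Set.range (X ∘ v : Fin c → MvPolynomial ι k))).map ε := by
    rw [Ideal.map_span, ← Set.range_comp]
    rfl
  have hiso' : ∃ N : ℕ, Ideal.span (Set.range f) ^ N ≤ (augmentationIdeal τ).colon (Ideal.span {(1 : A)}) := by
    obtain ⟨N, hN⟩ := hiso
    refine ⟨N, fun x hx => ?_⟩
    rw [Ideal.mem_colon_span_singleton, mul_one]
    rw [hspan, ← Ideal.map_pow] at hx
    exact haug (Ideal.map_mono hN hx)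
  -- the chain certificate `g = s` (KC3 ∘ KC5 with `β = 1`)
  have hchain' : ∀ l, 0 < w l ∧ ∃ u h : A, IsUnit h ∧ u ∈ (weightedFiltration f w).ideal (w l - 1) ∧
      τ u - u - 1 * h * f l ∈ Ideal.span {(1 : A)} * (weightedFiltration f w).ideal (w l + 1) := by
    intro l
    obtain ⟨u, h, hh, hu, hrowu⟩ := hchain l
    refine ⟨hw l, e.symm u, e.symm h, hh.map e.symm, hmemJ hu, h1J ?_⟩
    have e1 : τ (e.symm u) - e.symm u - 1 * e.symm h * f l = e.symm (σ u - u - h * X (v l)) := by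
      rw [hinc, one_mul, map_sub e.symm (σ u - u), map_mul]
    rw [e1]
    exact hmemJ hrowu
  have hcert : ∀ (hp' : 0 < p) (hσp : ∀ x, (⇑τ)^[p] x = x), ∃ g, CobordantKillCert f w τ hσJ hp' hσp g := fun hp' hσp =>
    ⟨_, cobordantKillCert_of_chains f w τ hσJ hp' hσp 1 hadm hiso' hchain'⟩
  -- K1′ in `A`, transported from `k[x]`
  have hK1 : RingTheory.Sequence.IsRegular A (List.ofFn f) :=
    IsRegular.of_ringEquiv_ofFn e.symm (X ∘ v) (isRegular_X_comp k v hv)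
  have hK1' : IsRegularRing (A ⧸ Ideal.span (Set.range f)) :=
    isRegularRing_quotient_of_ringEquiv e.symm (X ∘ v) (isRegularRing_quotient_X_comp k v)
  -- the cover theorem with the single chart `X′`
  obtain ⟨𝒦, d, hprin, hsupp, hchart, hfil, hZ⟩ := exists_isPrincipalCentre_filtration_eq_of_certCover (ι := Fin 1) hG hg₀
    (GModel.initial hq (stub_initialAtlas p hp q G ρ g₀ hg₀ hq hreg)) hreg (fun _ => O) (fun _ => hO)
    (fun _ => c) (fun _ => f) (fun _ => w) (fun _ => hc) (fun _ l => hw l) (fun _ => hK1) (fun _ => hK1')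
    (fun _ => hσJ) (fun _ => hcert) (fun _ _ _ _ _ _ => rfl)
    (B := X'.zeroLocus (U := ⊤) (Set.range f)) (X'.zeroLocus_isClosed _)
    (fun x _ => Set.mem_iUnion.mpr ⟨0, trivial⟩) (fun _ => Set.inter_subset_left)
  refine ⟨𝒦, d, hprin, hfil 0, le_antisymm hsupp fun x hx => hZ 0 ⟨hx, trivial⟩, fun O' hO' => ?_⟩
  obtain rfl : O' = O := Subtype.ext hO'
  exact hchart 0

/-- ★★★ **`KillsIn 1` FOR THE INITIAL MODEL OF A TRIANGULAR DATUM** (any `p`, any number of variables; `q` finite, `X₁ → Spec k′` locally of finite type):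
ONE admissible move — the weighted blow-up of the centre variables, `X′` itself a principal-centre chart — all of whose realisations carry a node atlas with
EMPTY formal locus. [OURS · L1 W4.5c · instance programme R-F15g made a family; NOT a statement of the manuscript] -/
theorem triangular_killsIn_one [Finite G] (hp : p.Prime) (hG : ∀ g : G, g ∈ Subgroup.zpowers g₀) (hg₀ : g₀ ^ p = 1)
    (hq : ∀ g : G, (ρ g).hom ≫ q = q) [IsIntegral X'] [IsLocallyNoetherian X'] [X'.IsSeparated] [IsAffine X'] [X₁.IsSeparated] [IsFinite q]
    (hreg : Scheme.IsRegular X') {k' : Type} [Field k'] (φ : X₁ ⟶ Spec (.of k')) [LocallyOfFiniteType φ]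
    {k : Type} [Field k] {ι : Type} [Fintype ι] [DecidableEq ι] (σ : MvPolynomial ι k ≃+* MvPolynomial ι k) (hC : ∀ a : k, σ (C a) = C a)
    {c : ℕ} (hc : 0 < c) (v : Fin c → ι) (hv : Function.Injective v) (w : Fin c → ℕ) (hw : ∀ l, 0 < w l)
    (hrow : ∀ i : ι, σ (X i) - X i ∈ (weightedFiltration (X ∘ v : Fin c → MvPolynomial ι k) w).ideal 1)
    (hrowc : ∀ l : Fin c, σ (X (v l)) - X (v l) ∈ (weightedFiltration (X ∘ v : Fin c → MvPolynomial ι k) w).ideal (w l + 1))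
    (hiso : ∃ N : ℕ, Ideal.span (Set.range (X ∘ v : Fin c → MvPolynomial ι k)) ^ N ≤ augmentationIdeal σ)
    (hchain : ∀ l : Fin c, ∃ u h : MvPolynomial ι k, IsUnit h ∧
      u ∈ (weightedFiltration (X ∘ v : Fin c → MvPolynomial ι k) w).ideal (w l - 1) ∧
      σ u - u - h * X (v l) ∈ (weightedFiltration (X ∘ v : Fin c → MvPolynomial ι k) w).ideal (w l + 1))
    (e : Γ(X', ⊤) ≃+* MvPolynomial ι k)
    (hστ : ∀ t : Γ(X', ⊤), e ((ρ g₀⁻¹).hom.appLE ⊤ ⊤ (by rw [Scheme.Hom.preimage_top]) t) = σ (e t))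
    (h₀ : NodeAtlas p (⟨ρ, hq⟩ : ActionOver q G) g₀) :
    KillsIn 1 (GModel.initial (p := p) (g₀ := g₀) hq h₀) := by
  obtain ⟨𝒦, d, hprin, -, -, hchart⟩ :=
    exists_isPrincipalCentre_initial_of_triangular (p := p) hp.pos hG hg₀ hq hreg σ hC hc v hv w hw hrow hrowc hiso hchain e hστ
  haveI : IsAffine (⊤ : X'.Opens) := isAffineOpen_top X'
  have hAff : IsAffineHom ((⊤ : X'.Opens).ι ≫ q) := inferInstance
  have hst : ∀ g : G, (ρ g).hom ⁻¹ᵁ (⊤ : X'.Opens) = ⊤ := fun g => Scheme.Hom.preimage_top _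
  let O : (GModel.initial (p := p) (g₀ := g₀) hq h₀).act.StableAffineOpens := ⟨⊤, hst, hAff⟩
  exact killsIn_one_of_principalCentreChart_top hp hG (GModel.initial hq h₀) (hasNoetherianBase_of_datum φ _)
    ⟨NodeAtlasData.ofNodeAtlas (p := p) (ρ := (⟨ρ, hq⟩ : ActionOver q G)) (g₀ := g₀) h₀⟩ 𝒦 d hprin O rfl (hchart O rfl)

/-- ★★★ **A TRIANGULAR DATUM satisfies the conclusion of `ReachLowerInF(X)`** at its initial model with ANY root decoration `𝔄₀`
(`exists_reachLowerF_of_killsIn_datum` on `triangular_killsIn_one`). [OURS · L1 W4.5c · instance programme R-F15g made a family; NOT a statement of the manuscript] -/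
theorem exists_reachLowerF_initial_of_triangular [Finite G] (hp : p.Prime) (hG : ∀ g : G, g ∈ Subgroup.zpowers g₀) (hg₀ : g₀ ^ p = 1)
    (hq : ∀ g : G, (ρ g).hom ≫ q = q) [IsIntegral X'] [IsLocallyNoetherian X'] [X'.IsSeparated] [IsAffine X'] [X₁.IsSeparated] [IsFinite q]
    (hreg : Scheme.IsRegular X') {k' : Type} [Field k'] (φ : X₁ ⟶ Spec (.of k')) [LocallyOfFiniteType φ]
    {k : Type} [Field k] {ι : Type} [Fintype ι] [DecidableEq ι] (σ : MvPolynomial ι k ≃+* MvPolynomial ι k) (hC : ∀ a : k, σ (C a) = C a)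
    {c : ℕ} (hc : 0 < c) (v : Fin c → ι) (hv : Function.Injective v) (w : Fin c → ℕ) (hw : ∀ l, 0 < w l)
    (hrow : ∀ i : ι, σ (X i) - X i ∈ (weightedFiltration (X ∘ v : Fin c → MvPolynomial ι k) w).ideal 1)
    (hrowc : ∀ l : Fin c, σ (X (v l)) - X (v l) ∈ (weightedFiltration (X ∘ v : Fin c → MvPolynomial ι k) w).ideal (w l + 1))
    (hiso : ∃ N : ℕ, Ideal.span (Set.range (X ∘ v : Fin c → MvPolynomial ι k)) ^ N ≤ augmentationIdeal σ)
    (hchain : ∀ l : Fin c, ∃ u h : MvPolynomial ι k, IsUnit h ∧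
      u ∈ (weightedFiltration (X ∘ v : Fin c → MvPolynomial ι k) w).ideal (w l - 1) ∧
      σ u - u - h * X (v l) ∈ (weightedFiltration (X ∘ v : Fin c → MvPolynomial ι k) w).ideal (w l + 1))
    (e : Γ(X', ⊤) ≃+* MvPolynomial ι k)
    (hστ : ∀ t : Γ(X', ⊤), e ((ρ g₀⁻¹).hom.appLE ⊤ ⊤ (by rw [Scheme.Hom.preimage_top]) t) = σ (e t))
    (h₀ : NodeAtlas p (⟨ρ, hq⟩ : ActionOver q G) g₀) (𝔄₀ : NodeAtlasData p (GModel.initial hq h₀).act g₀) :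
    ∃ P : ∀ M : GModel p q G ρ g₀, NodeAtlasData p M.act g₀ → Prop,
      P (GModel.initial hq h₀) 𝔄₀ ∧ ∀ (M : GModel p q G ρ g₀) (𝔄 : NodeAtlasData p M.act g₀), P M 𝔄 → ¬ M.Terminal →
        ∃ n : ℕ, TreeF P (fun N 𝔅 => LexLTF N 𝔅 M 𝔄) n M 𝔄 :=
  exists_reachLowerF_of_killsIn_datum hp hG φ (GModel.initial hq h₀) 𝔄₀
    (triangular_killsIn_one hp hG hg₀ hq hreg φ σ hC hc v hv w hw hrow hrowc hiso hchain e hστ h₀)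

/-! ## Two new inhabitants: the triangular germ sm and the transvection -/

/-- ★ **`KillsIn 1` for the sm datum** (σ: `x₁ ↦ x₁ + x₀`, `x₂ ↦ x₂ + x₀`, `x₃ ↦ x₃ + x₂`, `x₀` and constants fixed; X-CERT v1.3-SMALLP menu «sm», datum inhabited
for `p ≥ 3`): centre (x₀:2, x₂:1), chains `u = (x₂, x₃)`. [OURS · L1 W4.5c · I-5 menu; NOT a statement of the manuscript] -/
theorem sm_killsIn_one [Finite G] (hp : p.Prime) (hG : ∀ g : G, g ∈ Subgroup.zpowers g₀) (hg₀ : g₀ ^ p = 1)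
    (hq : ∀ g : G, (ρ g).hom ≫ q = q) [IsIntegral X'] [IsLocallyNoetherian X'] [X'.IsSeparated] [IsAffine X'] [X₁.IsSeparated] [IsFinite q]
    (hreg : Scheme.IsRegular X') {k' : Type} [Field k'] (φ : X₁ ⟶ Spec (.of k')) [LocallyOfFiniteType φ]
    {k : Type} [Field k] (σ : MvPolynomial (Fin 4) k ≃+* MvPolynomial (Fin 4) k) (hC : ∀ a : k, σ (C a) = C a)
    (h0 : σ (X 0) = X 0) (h1 : σ (X 1) = X 1 + X 0) (h2 : σ (X 2) = X 2 + X 0) (h3 : σ (X 3) = X 3 + X 2)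
    (e : Γ(X', ⊤) ≃+* MvPolynomial (Fin 4) k)
    (hστ : ∀ t : Γ(X', ⊤), e ((ρ g₀⁻¹).hom.appLE ⊤ ⊤ (by rw [Scheme.Hom.preimage_top]) t) = σ (e t))
    (h₀ : NodeAtlas p (⟨ρ, hq⟩ : ActionOver q G) g₀) :
    KillsIn 1 (GModel.initial (p := p) (g₀ := g₀) hq h₀) := by
  -- centre variables `v = (0, 2)`, weights `w = (2, 1)`
  let v : Fin 2 → Fin 4 := ![0, 2]
  let w : Fin 2 → ℕ := ![2, 1]
  have hv : Function.Injective v := by decide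
  have hX0 : (X 0 : MvPolynomial (Fin 4) k) ∈ (weightedFiltration (X ∘ v : Fin 2 → MvPolynomial (Fin 4) k) w).ideal 2 :=
    mem_weightedFiltration_ideal (X ∘ v : Fin 2 → MvPolynomial (Fin 4) k) w 0
  have hX2 : (X 2 : MvPolynomial (Fin 4) k) ∈ (weightedFiltration (X ∘ v : Fin 2 → MvPolynomial (Fin 4) k) w).ideal 1 :=
    mem_weightedFiltration_ideal (X ∘ v : Fin 2 → MvPolynomial (Fin 4) k) w 1
  have hX0' : (X 0 : MvPolynomial (Fin 4) k) ∈ (weightedFiltration (X ∘ v : Fin 2 → MvPolynomial (Fin 4) k) w).ideal 1 :=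
    (weightedFiltration _ w).antitone (by norm_num : 1 ≤ 2) hX0
  have hinc0 : σ (X 0) - X 0 = 0 := by rw [h0, sub_self]
  have hinc1 : σ (X 1) - X 1 = X 0 := by rw [h1]; ring
  have hinc2 : σ (X 2) - X 2 = X 0 := by rw [h2]; ring
  have hinc3 : σ (X 3) - X 3 = X 2 := by rw [h3]; ring
  refine triangular_killsIn_one hp hG hg₀ hq hreg φ σ hC (by norm_num : 0 < 2) v hv w (fun l => by fin_cases l <;> decide) ?_ ?_ ?_ ?_ e hστ h₀
  · intro i
    fin_cases i
    · change σ (X 0) - X 0 ∈ _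
      rw [hinc0]; exact Ideal.zero_mem _
    · change σ (X 1) - X 1 ∈ _
      rw [hinc1]; exact hX0'
    · change σ (X 2) - X 2 ∈ _
      rw [hinc2]; exact hX0'
    · change σ (X 3) - X 3 ∈ _
      rw [hinc3]; exact hX2
  · intro l
    fin_cases l
    · change σ (X 0) - X 0 ∈ _
      rw [hinc0]; exact Ideal.zero_mem _
    · change σ (X 2) - X 2 ∈ (weightedFiltration (X ∘ v : Fin 2 → MvPolynomial (Fin 4) k) w).ideal 2
      rw [hinc2]; exact hX0
  · refine ⟨1, ?_⟩
    rw [pow_one, Ideal.span_le]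
    rintro _ ⟨l, rfl⟩
    fin_cases l
    · change (X 0 : MvPolynomial (Fin 4) k) ∈ _
      rw [← hinc1]; exact sub_mem_augmentationIdeal σ _
    · change (X 2 : MvPolynomial (Fin 4) k) ∈ _
      rw [← hinc3]; exact sub_mem_augmentationIdeal σ _
  · intro l
    fin_cases l
    · refine ⟨X 2, 1, isUnit_one, hX2, ?_⟩
      change σ (X 2) - X 2 - 1 * X 0 ∈ _
      rw [hinc2, one_mul, sub_self]; exact Ideal.zero_mem _
    · refine ⟨X 3, 1, isUnit_one, ?_, ?_⟩
      · change (X 3 : MvPolynomial (Fin 4) k) ∈ (weightedFiltration (X ∘ v : Fin 2 → MvPolynomial (Fin 4) k) w).ideal 0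
        exact mem_weightedFiltration_zero _ w _
      change σ (X 3) - X 3 - 1 * X 2 ∈ _
      rw [hinc3, one_mul, sub_self]; exact Ideal.zero_mem _

/-- ★ **`KillsIn 1` for the transvection datum** (σ: `x₁ ↦ x₁ + x₀`, `x₀, x₂, x₃` and constants fixed; `J₂ ⊕ 1 ⊕ 1`, every `p`): centre (x₀:1) — the
blow-up of the fixed hyperplane (an isomorphism downstairs) is a legal kill move of the game; chain `u = x₁`. [OURS · L1 W4.5c · I-5 family; NOT a statement
of the manuscript] -/
theorem transvection_killsIn_one [Finite G] (hp : p.Prime) (hG : ∀ g : G, g ∈ Subgroup.zpowers g₀) (hg₀ : g₀ ^ p = 1)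
    (hq : ∀ g : G, (ρ g).hom ≫ q = q) [IsIntegral X'] [IsLocallyNoetherian X'] [X'.IsSeparated] [IsAffine X'] [X₁.IsSeparated] [IsFinite q]
    (hreg : Scheme.IsRegular X') {k' : Type} [Field k'] (φ : X₁ ⟶ Spec (.of k')) [LocallyOfFiniteType φ]
    {k : Type} [Field k] (σ : MvPolynomial (Fin 4) k ≃+* MvPolynomial (Fin 4) k) (hC : ∀ a : k, σ (C a) = C a)
    (h0 : σ (X 0) = X 0) (h1 : σ (X 1) = X 1 + X 0) (h2 : σ (X 2) = X 2) (h3 : σ (X 3) = X 3)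
    (e : Γ(X', ⊤) ≃+* MvPolynomial (Fin 4) k)
    (hστ : ∀ t : Γ(X', ⊤), e ((ρ g₀⁻¹).hom.appLE ⊤ ⊤ (by rw [Scheme.Hom.preimage_top]) t) = σ (e t))
    (h₀ : NodeAtlas p (⟨ρ, hq⟩ : ActionOver q G) g₀) :
    KillsIn 1 (GModel.initial (p := p) (g₀ := g₀) hq h₀) := by
  let v : Fin 1 → Fin 4 := ![0]
  let w : Fin 1 → ℕ := ![1]
  have hv : Function.Injective v := Function.injective_of_subsingleton v
  have hX0 : (X 0 : MvPolynomial (Fin 4) k) ∈ (weightedFiltration (X ∘ v : Fin 1 → MvPolynomial (Fin 4) k) w).ideal 1 :=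
    mem_weightedFiltration_ideal (X ∘ v : Fin 1 → MvPolynomial (Fin 4) k) w 0
  have hinc0 : σ (X 0) - X 0 = 0 := by rw [h0, sub_self]
  have hinc1 : σ (X 1) - X 1 = X 0 := by rw [h1]; ring
  have hinc2 : σ (X 2) - X 2 = 0 := by rw [h2, sub_self]
  have hinc3 : σ (X 3) - X 3 = 0 := by rw [h3, sub_self]
  refine triangular_killsIn_one hp hG hg₀ hq hreg φ σ hC (by norm_num : 0 < 1) v hv w (fun l => by fin_cases l; decide) ?_ ?_ ?_ ?_ e hστ h₀
  · intro i
    fin_cases i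
    · change σ (X 0) - X 0 ∈ _
      rw [hinc0]; exact Ideal.zero_mem _
    · change σ (X 1) - X 1 ∈ _
      rw [hinc1]; exact hX0
    · change σ (X 2) - X 2 ∈ _
      rw [hinc2]; exact Ideal.zero_mem _
    · change σ (X 3) - X 3 ∈ _
      rw [hinc3]; exact Ideal.zero_mem _
  · intro l
    fin_cases l
    change σ (X 0) - X 0 ∈ _
    rw [hinc0]; exact Ideal.zero_mem _
  · refine ⟨1, ?_⟩
    rw [pow_one, Ideal.span_le]
    rintro _ ⟨l, rfl⟩
    fin_cases l
    change (X 0 : MvPolynomial (Fin 4) k) ∈ _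
    rw [← hinc1]; exact sub_mem_augmentationIdeal σ _
  · intro l
    fin_cases l
    refine ⟨X 1, 1, isUnit_one, ?_, ?_⟩
    · change (X 1 : MvPolynomial (Fin 4) k) ∈ (weightedFiltration (X ∘ v : Fin 1 → MvPolynomial (Fin 4) k) w).ideal 0
      exact mem_weightedFiltration_zero _ w _
    change σ (X 1) - X 1 - 1 * X 0 ∈ _
    rw [hinc1, one_mul, sub_self]; exact Ideal.zero_mem _

end Summit.ResolutionOfSingularities.ResolutionOfSingularities.Theorems.WildQuotientResolution.S1.GameFrame.GModel

end
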